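import Literature.NumberTheory.Automorphic.ArchHeckeTestVectorGammaGL2
import HarnessLib

/-!
# `frobSatakeCompatibleAt_of_isPiOfArtinRep` holds
# (Gelbart (1997), Prop. 4.1 at the `π`-unramified places — discharge of the named fact)

Topic `NumberTheory/Automorphic`; namespace `Literature.NumberTheory.Automorphic`. One theorem (no definition,
no named fact, no instance): the discharge `frobSatakeCompatibleAt_of_isPiOfArtinRep_holds` of the named fact of
`Automorphic/StrongArtinGL2` (Gelbart, *Three lectures on the modularity of `ρ̄_{E,3}` and the Langlands
reciprocity conjecture* (1997), Prop. 4.1, printed p. 178 = PDF p. 236 of the volume: a cuspidal `π` of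
`GL₂(𝔸_F)` with `trace t_{π_v} = trace σ_v(Fr_v)` for almost all `v` satisfies `π_v = π(σ_v)` at every place;
here its unramified shadow at the places where `π` has a Satake parameter).

Its `σ`-unramified companion `frobSatakeCompatibleAt_of_isPiOfArtinRep_of_isUnramifiedAt`
(`Automorphic/PiOfArtinRepAtSigmaUnramifiedPlaces`) is the landed theorem
`frobSatakeCompatibleAt_of_isUnramifiedAt_of_archKirillovGammaProduct'` of `ArchHeckeTestVectorGammaGL2`, and the
present fact is the second component of the landed conjunction
`twistedHeckeTheoryGL2_and_frobSatakeCompatibleAt_of_archKirillovGammaProduct'` (same file): Jacquet–Langlands'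
proof (LNM 114 (1970): the Galois-twisted Hecke theory `JacquetLanglands1970_twistedHeckeTheoryGL2` = Thm. 11.1 /
Cor. 11.2 with the archimedean factors of Thm. 5.15 / Thm. 6.4, then Lemma 12.5 and the quotient of the two
global functional equations in the proof of Thm. 12.2), formalised bottom-up in
`PiOfArtinRepOfTwistedHeckeTheoryGL2Proofs` (the fact from the twisted Hecke theory), the
`StrongArtinGL2…Proofs` files (local rigidity, global quotient), the `HeckeEulerFactorisationGL2…` /
`StandardLTheoryGL2…` files (Thm. 11.1 from one archimedean test vector) and
`ArchHeckeTestVectorConstructionGL2` / `…DualGL2` / `…GammaGL2` (the test vector).  This file only names the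
discharge, so that users of `(h : frobSatakeCompatibleAt_of_isPiOfArtinRep)` — e.g.
`frobSatakeCompatibleAt_of_isPiOfArtinRep_holds_of` of `StrongArtinGL2OfAutomorphicHalf`, whose second
antecedent `JacquetLanglands1970_twistedCuspidalPackage` is thereby bypassed — can be fed a closed term.

## References

* S. Gelbart, *Three lectures on the modularity of `ρ̄_{E,3}` and the Langlands reciprocity conjecture*, in
  *Modular Forms and Fermat's Last Theorem* (Cornell–Silverman–Stevens eds.), Springer (1997), 155–207,
  Prop. 4.1 (p. 178). doi:10.1007/978-1-4612-1974-3_6 [Gelbart1997]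
* H. Jacquet, R. P. Langlands, *Automorphic Forms on GL(2)*, LNM 114 (1970): Thm. 5.15, Thm. 6.4, Thm. 11.1,
  Cor. 11.2, Lemma 12.5, proof of Thm. 12.2. [JacquetLanglands1970]
-/

namespace Literature.NumberTheory.Automorphic

/-- **Gelbart (1997), Prop. 4.1 at the `π`-unramified places — the named fact
`frobSatakeCompatibleAt_of_isPiOfArtinRep` holds**: if a cuspidal automorphic representation `π` of
`GL₂(𝔸_F)` is `π(σ)` for a two-dimensional Artin representation `σ` (Frobenius–Satake compatible at almost
all places), then at EVERY finite place `v` at which `π` has a Satake parameter `α`, `σ` is unramified and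
`charpoly σ(Frob_v) = ∏_{a ∈ α} (X - a)`.  Proof: Jacquet–Langlands (1970), Thm. 11.1 / Cor. 11.2 (twisted
Hecke theory, archimedean factors from Thm. 5.15 / Thm. 6.4) + Lemma 12.5 + proof of Thm. 12.2, as formalised
in the tree (second component of `twistedHeckeTheoryGL2_and_frobSatakeCompatibleAt_of_archKirillovGammaProduct'`).
[cite: Gelbart1997, Prop. 4.1 (p. 178)] [cite: JacquetLanglands1970, Thm. 11.1, Cor. 11.2, Lemma 12.5, Thm. 12.2] -/
theorem frobSatakeCompatibleAt_of_isPiOfArtinRep_holds : frobSatakeCompatibleAt_of_isPiOfArtinRep :=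
  twistedHeckeTheoryGL2_and_frobSatakeCompatibleAt_of_archKirillovGammaProduct'.2

end Literature.NumberTheory.Automorphic
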